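import Summits.QuantumFields.QCD.Theses.HeatSlicedQuarks
import Summits.QuantumFields.QCD.Theorems.RobustYangMillsHandover.Negative.FreeWilsonModes
import Summits.QuantumFields.QCD.Theorems.ActionBoundsLowModes.Negative.LoadBearing

/-!
# Load-bearing hypotheses of the `low-mode-quarantine` mechanism stubs
(crux `Summit.QuantumFields.QCD.Theses.HeatSlicedQuarks.RobustYangMillsHandover`, stmt-QuantumFields-8892;
drefute seat, line `Cruxes/RobustYangMillsHandover/Lines/low-mode-quarantine.lean`)

Kernel-checked small-model facts about the registered stubs `stub_smoothFieldFloor` and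
`stub_lowModesHugRoughness` ("any proof must use the mass-window floor `m₀ ≤ |m|`"):

* `smoothFieldFloor_false_without_massFloor` — with the hypothesis `m₀ ≤ |m|` dropped, the smooth-field
  spectral floor `‖D_W v‖² ≥ (m₀²/2)‖v‖²` is false: on the `1⁴` torus at `U ≡ 1`, `m = 0`, every plaquette
  deficit vanishes and the constant colour–spin field is annihilated by the tree's `wilsonDirac`
  (landed `Negative.wilsonDirac_one_mulVec_const_eq_smul`).
* `highBlockLocality_false_with_constPrefactor` — the `λ`-dependence of the prefactor `C/λ` in
  `stub_highBlockLocality` is load-bearing: with a `λ`-independent constant the bound fails at the same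
  point (`H = 0` on the `1⁴` torus at `U ≡ 1`, `m = 0`, so `(H + λ)⁻¹ = λ⁻¹ • 1`; landed
  `ActionBoundsLowModes.Negative.wilsonDirac_trivialConfig_one`).
* `lowModesHugRoughness_false_without_massFloor` — same witness: a zero mode of `H = D_Wᴴ D_W` on a field
  with NO `ε₀`-rough plaquette, so the distance hypothesis of the stub holds vacuously for every `n` and the
  claimed bound `C e^{−cn} ‖v‖²` fails for `n` large (`n = ⌈C/c⌉₊ + 1`).

Reading for the lead: both stubs are statements about the window `|m| ≥ m₀` only; at `|m| < m₀/√2` the free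
constant mode (momentum `0`, no doublers involved) already sits below the claimed floor, on every torus.
Nothing here asserts a Theses decl positively.
-/

namespace Summit.QuantumFields.QCD.Theorems.RobustYangMillsHandover.Negative

open Literature.MathematicalPhysics.QuantumLattice Literature.MathematicalPhysics.QuantumFieldTheory
open Literature.Probability.LatticeModels Matrix Finset
open Summit.QuantumFields.QCD.Theorems.ActionBoundsLowModes.Negative (trivialConfig wilsonDirac_trivialConfig_one)

/-- `stub_smoothFieldFloor` of `Lines/low-mode-quarantine.lean` with the window floor `m₀ ≤ |m|` DROPPED
(a named variant of a line stub, not a literature fact). -/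
def SmoothFieldFloorWithoutMassFloor : Prop :=
  ∀ m₀ : ℝ, 0 < m₀ → m₀ ≤ 1 → ∃ ε₀ : ℝ, 0 < ε₀ ∧
    ∀ (L : ℕ) [NeZero L] (U : GaugeConfig 4 L (Matrix.specialUnitaryGroup (Fin 3) ℂ)) (m : ℝ),
      m ∈ Set.Icc (-(1 / 2 : ℝ)) 1 →
      (∀ (y : TorusSite 4 L) (μ ν : Fin 4),
        3 - ((fundamentalRep (Fin 3) (plaquetteHolonomy U y μ ν)).trace).re ≤ ε₀) →
        ∀ v : TorusSite 4 L × Fin 3 × Fin 4 → ℂ,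
          m₀ ^ 2 / 2 * ∑ i, ‖v i‖ ^ 2 ≤
            ∑ i, ‖(wilsonDirac (fundamentalRep (Fin 3)) U m 1).mulVec v i‖ ^ 2

/-- `stub_lowModesHugRoughness` of `Lines/low-mode-quarantine.lean` with the window floor `m₀ ≤ |m|` DROPPED
(a named variant of a line stub, not a literature fact). -/
def LowModesHugRoughnessWithoutMassFloor : Prop :=
  ∀ m₀ : ℝ, 0 < m₀ → m₀ ≤ 1 → ∃ ε₀ c C : ℝ, 0 < ε₀ ∧ 0 < c ∧ 0 < C ∧
    ∀ (L : ℕ) [NeZero L] (U : GaugeConfig 4 L (Matrix.specialUnitaryGroup (Fin 3) ℂ)) (m : ℝ),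
      m ∈ Set.Icc (-(1 / 2 : ℝ)) 1 →
      ∀ (v : TorusSite 4 L × Fin 3 × Fin 4 → ℂ) (e : ℝ), 0 ≤ e → e ≤ m₀ ^ 2 / 4 →
        ((wilsonDirac (fundamentalRep (Fin 3)) U m 1)ᴴ *
            wilsonDirac (fundamentalRep (Fin 3)) U m 1).mulVec v = (e : ℂ) • v →
          ∀ (x : TorusSite 4 L) (n : ℕ),
            (∀ y : TorusSite 4 L,
              (∃ μ ν : Fin 4, ε₀ ≤ 3 - ((fundamentalRep (Fin 3) (plaquetteHolonomy U y μ ν)).trace).re) →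
                n ≤ torusDist x y) →
            ∑ a : Fin 3, ∑ α : Fin 4, ‖v (x, a, α)‖ ^ 2 ≤
              C * Real.exp (-(c * n)) * ∑ i, ‖v i‖ ^ 2

/-- All plaquette holonomies of the identity configuration are `1`, so every deficit is `0`. [folklore] -/
theorem trace_re_plaquetteHolonomy_one (L : ℕ) (y : TorusSite 4 L) (μ ν : Fin 4) :
    ((fundamentalRep (Fin 3)
      (plaquetteHolonomy (1 : GaugeConfig 4 L (Matrix.specialUnitaryGroup (Fin 3) ℂ)) y μ ν)).trace).re = 3 := by
  simp [plaquetteHolonomy, Matrix.trace_one]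

/-- On the `1⁴` torus at `U ≡ 1`, `m = 0` the constant field `1` is annihilated by the Wilson–Dirac operator. [folklore] -/
theorem wilsonDirac_one_zero_mulVec_const_one :
    (wilsonDirac (fundamentalRep (Fin 3))
        (1 : GaugeConfig 4 1 (Matrix.specialUnitaryGroup (Fin 3) ℂ)) 0 1).mulVec (fun _ => (1 : ℂ)) = 0 := by
  have h := wilsonDirac_one_mulVec_const_eq_smul (L := 1) (fundamentalRep (Fin 3)) (0 : ℝ) (1 : ℝ)
    (fun _ : Fin 3 × Fin 4 => (1 : ℂ))
  simpa using h

/-- **The window floor `m₀ ≤ |m|` is load-bearing for `stub_smoothFieldFloor`.** [folklore] -/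
theorem smoothFieldFloor_false_without_massFloor : ¬ SmoothFieldFloorWithoutMassFloor := by
  intro h
  obtain ⟨ε₀, hε₀, hmain⟩ := h 1 one_pos le_rfl
  have hsmooth : ∀ (y : TorusSite 4 1) (μ ν : Fin 4),
      3 - ((fundamentalRep (Fin 3) (plaquetteHolonomy
        (1 : GaugeConfig 4 1 (Matrix.specialUnitaryGroup (Fin 3) ℂ)) y μ ν)).trace).re ≤ ε₀ := by
    intro y μ ν
    rw [trace_re_plaquetteHolonomy_one]
    linarith
  have key := hmain 1 (1 : GaugeConfig 4 1 (Matrix.specialUnitaryGroup (Fin 3) ℂ)) 0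
    ⟨by norm_num, by norm_num⟩ hsmooth (fun _ => (1 : ℂ))
  rw [wilsonDirac_one_zero_mulVec_const_one] at key
  simp only [Pi.zero_apply, norm_zero, ne_eq, OfNat.ofNat_ne_zero, not_false_eq_true, zero_pow,
    Finset.sum_const_zero] at key
  -- `key : 1 ^ 2 / 2 * ∑ i, ‖(1:ℂ)‖ ^ 2 ≤ 0`, i.e. `6 ≤ 0`
  norm_num at key

/-- **The window floor `m₀ ≤ |m|` is load-bearing for `stub_lowModesHugRoughness`.** [folklore] -/
theorem lowModesHugRoughness_false_without_massFloor : ¬ LowModesHugRoughnessWithoutMassFloor := by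
  intro h
  obtain ⟨ε₀, c, C, hε₀, hc, hC, hmain⟩ := h 1 one_pos le_rfl
  set N : ℕ := ⌈C / c⌉₊ + 1 with hN
  -- the eigen-equation `H v = 0 • v` for the constant field
  have heig : ((wilsonDirac (fundamentalRep (Fin 3))
        (1 : GaugeConfig 4 1 (Matrix.specialUnitaryGroup (Fin 3) ℂ)) 0 1)ᴴ *
        wilsonDirac (fundamentalRep (Fin 3))
          (1 : GaugeConfig 4 1 (Matrix.specialUnitaryGroup (Fin 3) ℂ)) 0 1).mulVec (fun _ => (1 : ℂ)) =
      ((0 : ℝ) : ℂ) • (fun _ => (1 : ℂ)) := by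
    rw [← Matrix.mulVec_mulVec, wilsonDirac_one_zero_mulVec_const_one, Matrix.mulVec_zero]
    simp
  -- no plaquette is rough, so the distance hypothesis is vacuous for every `n`
  have hdist : ∀ y : TorusSite 4 1,
      (∃ μ ν : Fin 4, ε₀ ≤ 3 - ((fundamentalRep (Fin 3) (plaquetteHolonomy
        (1 : GaugeConfig 4 1 (Matrix.specialUnitaryGroup (Fin 3) ℂ)) y μ ν)).trace).re) →
        N ≤ torusDist (0 : TorusSite 4 1) y := by
    rintro y ⟨μ, ν, hμν⟩
    rw [trace_re_plaquetteHolonomy_one] at hμν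
    linarith
  have key := hmain 1 (1 : GaugeConfig 4 1 (Matrix.specialUnitaryGroup (Fin 3) ℂ)) 0
    ⟨by norm_num, by norm_num⟩ (fun _ => (1 : ℂ)) 0 le_rfl (by norm_num) heig 0 N hdist
  -- evaluate both sides: 12 ≤ C e^{-cN} · 12
  simp only [norm_one, one_pow, Finset.sum_const, Finset.card_univ, nsmul_eq_mul, mul_one] at key
  have hcard : (Fintype.card (TorusSite 4 1 × Fin 3 × Fin 4) : ℝ) = 12 := by
    simp [Fintype.card_prod, Fintype.card_fin]
  rw [hcard] at key
  norm_num at key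
  -- `key : 12 ≤ C * rexp (-(c * N)) * 12` (or an equivalent normal form); contradiction with `C e^{-cN} < 1`
  have hN1 : C < c * (N : ℝ) := by
    have h1 : C / c ≤ (⌈C / c⌉₊ : ℝ) := Nat.le_ceil _
    have h2 : (N : ℝ) = (⌈C / c⌉₊ : ℝ) + 1 := by simp [hN]
    rw [h2, mul_add, mul_one]
    have : C ≤ c * (⌈C / c⌉₊ : ℝ) := by
      calc C = c * (C / c) := by field_simp
        _ ≤ c * (⌈C / c⌉₊ : ℝ) := by exact mul_le_mul_of_nonneg_left h1 hc.le
    linarith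
  have hexp : c * (N : ℝ) < Real.exp (c * (N : ℝ)) := by
    have := Real.add_one_le_exp (c * (N : ℝ))
    linarith
  have hlt : C * Real.exp (-(c * (N : ℝ))) < 1 := by
    rw [Real.exp_neg]
    have hpos : 0 < Real.exp (c * (N : ℝ)) := Real.exp_pos _
    rw [mul_inv_lt_iff₀ hpos]
    linarith
  nlinarith [key, hlt, Real.exp_pos (-(c * (N : ℝ)))]

/-- `stub_highBlockLocality` of `Lines/low-mode-quarantine.lean` with the prefactor `C / λ` replaced by a
`λ`-INDEPENDENT constant `C` (a named variant of a line stub, not a literature fact). -/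
def HighBlockLocalityConstPrefactor : Prop :=
  ∃ C c : ℝ, 0 < c ∧
    ∀ (L : ℕ) [NeZero L] (U : GaugeConfig 4 L (Matrix.specialUnitaryGroup (Fin 3) ℂ)) (m : ℝ),
      m ∈ Set.Icc (-1 : ℝ) 1 → ∀ lam : ℝ, 0 < lam → lam ≤ 1 →
        ∀ (x y : TorusSite 4 L) (a b : Fin 3) (α β : Fin 4),
          ‖((wilsonDirac (fundamentalRep (Fin 3)) U m 1)ᴴ * wilsonDirac (fundamentalRep (Fin 3)) U m 1 +
              (lam : ℂ) • (1 : Matrix (TorusSite 4 L × Fin 3 × Fin 4) (TorusSite 4 L × Fin 3 × Fin 4) ℂ))⁻¹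
              (x, a, α) (y, b, β)‖ ≤
            C * Real.exp (-(c * Real.sqrt lam * torusDist x y))

/-- On the `1⁴` torus at `U ≡ 1`, `m = 0`: `H = D_Wᴴ D_W = 0`, so the shifted resolvent is `λ⁻¹ • 1`. [folklore] -/
theorem resolvent_trivialConfig_one_zero (lam : ℝ) (hlam : lam ≠ 0) :
    ((wilsonDirac (fundamentalRep (Fin 3)) (trivialConfig 1) 0 1)ᴴ *
          wilsonDirac (fundamentalRep (Fin 3)) (trivialConfig 1) 0 1 +
        (lam : ℂ) • (1 : Matrix (TorusSite 4 1 × Fin 3 × Fin 4) (TorusSite 4 1 × Fin 3 × Fin 4) ℂ))⁻¹ =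
      ((lam : ℂ)⁻¹) • (1 : Matrix (TorusSite 4 1 × Fin 3 × Fin 4) (TorusSite 4 1 × Fin 3 × Fin 4) ℂ) := by
  have hH : (wilsonDirac (fundamentalRep (Fin 3)) (trivialConfig 1) 0 1)ᴴ *
      wilsonDirac (fundamentalRep (Fin 3)) (trivialConfig 1) 0 1 = 0 := by
    rw [wilsonDirac_trivialConfig_one]
    simp
  rw [hH, zero_add]
  have hlamC : (lam : ℂ) ≠ 0 := by exact_mod_cast hlam
  apply Matrix.inv_eq_left_inv
  rw [Matrix.smul_mul, Matrix.one_mul, smul_smul, inv_mul_cancel₀ hlamC, one_smul]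

/-- **The `1/λ` in `stub_highBlockLocality` is load-bearing**: no `λ`-independent prefactor works
(the quarantine threshold `λ = m₀²/4` enters the high-block constants as `1/λ`). [folklore] -/
theorem highBlockLocality_false_with_constPrefactor : ¬ HighBlockLocalityConstPrefactor := by
  rintro ⟨C, c, hc, h⟩
  set lam : ℝ := 1 / (|C| + 2) with hlam_def
  have hden : 0 < |C| + 2 := by positivity
  have hlam0 : 0 < lam := by rw [hlam_def]; positivity
  have hlam1 : lam ≤ 1 := by
    rw [hlam_def, div_le_one hden]
    linarith [abs_nonneg C]
  have key := h 1 (trivialConfig 1) 0 (by norm_num) lam hlam0 hlam1 0 0 0 0 0 0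
  rw [resolvent_trivialConfig_one_zero lam hlam0.ne'] at key
  have hentry : ‖(((lam : ℂ)⁻¹) • (1 : Matrix (TorusSite 4 1 × Fin 3 × Fin 4)
      (TorusSite 4 1 × Fin 3 × Fin 4) ℂ)) ((0 : TorusSite 4 1), (0 : Fin 3), (0 : Fin 4))
        ((0 : TorusSite 4 1), (0 : Fin 3), (0 : Fin 4))‖ = lam⁻¹ := by
    rw [Matrix.smul_apply, Matrix.one_apply_eq, smul_eq_mul, mul_one, norm_inv, Complex.norm_real,
      Real.norm_eq_abs, abs_of_pos hlam0]
  rw [hentry] at key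
  simp only [torusDist_self, Nat.cast_zero, mul_zero, neg_zero, Real.exp_zero, mul_one] at key
  have hinv : lam⁻¹ = |C| + 2 := by rw [hlam_def, one_div, inv_inv]
  rw [hinv] at key
  linarith [le_abs_self C]

end Summit.QuantumFields.QCD.Theorems.RobustYangMillsHandover.Negative
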